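import Mathlib
import Summits.PneNP.PneNP.Theses.LatticeMagic
import Summits.PneNP.PneNP.Theorems.LatticeMagicTargetIffNPneCoNP
import Summits.PneNP.PneNP.Theorems.LatticeMagicTargetDefs
import Summits.PneNP.PneNP.Theorems.LatticeMagicTargetSqueezeStrength
import Summits.PneNP.PneNP.Theorems.LatticeMagicTargetSqueezeVacuity
import Summits.PneNP.PneNP.Theorems.LatticeMagicTargetStubLevin
import Summits.PneNP.PneNP.Theorems.LatticeMagicTargetStubBridge
import Summits.PneNP.PneNP.Theorems.LatticeMagicTargetStubGame

/-!
# Route LatticeMagic, crux `Target` (stmt-PneNP-10709) — line `SketchIdeator5`: the assembled conditional bridge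

The line `SketchIdeator5` (card `kpt-squeeze-ideal-lattice-leg`: Krajíček's model-extension squeeze,
J. Krajíček, arXiv:2506.20221, Thm 4.1, with a cryptographic leg fed by an INJECTIVE one-way family)
has all its glue stubs landed as tree theorems (`stub_game`, `stub_levin`, `stub_bridge`, `stub_amgm`).
This file assembles them into the hypothesis-explicit statements that survive the line:

* `st_of_injOWF` — **Krajíček's Hypothesis (ST) from an injective one-way family**: if some p-time `g`
  is injective on every length and one-way with a hard-core predicate `B`, then some Cook–Reckhow proof
  system `V` for `TAUT` has its disjoint-disjunction search problem `DD_V` hard for `FP` students with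
  `O(1)` rounds (`STHyp V`). This is the uniform, injective-family form of Krajíček, *A limitation on the
  KPT interpolation*, LMCS 16(3:9) 2020 (there: one-way PERMUTATIONS, non-uniform security, strong pps) =
  arXiv:2506.20221 Lemma 2.2; composed from the FIRST LEMMA `stub_game` (hard-core bit ⇒ hard bit-vector
  game), `stub_levin` (Cook–Levin with the Levin witness map) and `stub_bridge`.
* `st_of_oneWayPermutation` — the same from a uniform one-way permutation (via the tree's proved
  Goldreich–Levin, `injOWF_of_oneWayPermutation`).
* `latticeMagicTarget_of_injOWF_of_squeeze` — the line's closure of the crux MODULO ITS TWO APEXES: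
  apex A (injective OWF with hard-core bit) and apex B (Thm 4.1 with MEP folded in: every pps with an
  ST-hard DD problem forces `NP ≠ coNP`) give `Target`.
* `squeeze_iff_NP_ne_coNP_of_injOWF` — and the kernel-checked price: GIVEN apex A, apex B is EQUIVALENT
  to `NP ≠ coNP`, i.e. to the crux itself (`latticeMagicTarget_iff_NP_ne_coNP`); together with
  `pneNP_of_injOWF` (apex A ⇒ the summit) this is why the line is recorded dead-by-strength.
-/

set_option linter.dupNamespace false -- `Summit.PneNP.PneNP.…`: summit = sub-problem (D-0017)

namespace Summit.PneNP.PneNP.Theorems.LatticeMagicTarget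

open Literature.Computability.Complexity Literature.Computability.Cryptography
open Literature.Computability.MetaComplexity
open _root_.Computability
open Summit.PneNP.PneNP.Theses.LatticeMagic (Target)

/-- **Hypothesis (ST) from an injective one-way family with a hard-core bit** (registered sub-goal
`st_of_injOWF`): compose `stub_game` (the hard bit-vector game is hard), `stub_levin` (Levin witness
map) and `stub_bridge` (the proof system `V` and the student simulation). Only the polynomial-time parts
of `IsOneWay g` / `IsHardCorePredicate B g` enter the bridge; one-wayness enters through the game;
length-regularity is not needed. [cite: Krajicek2020KPT, main theorem (there for one-way permutations)] -/
theorem st_of_injOWF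
    (hA : ∃ (g : List Bool → List Bool) (B : List Bool → Bool),
      InjOnLengths g ∧ IsLengthRegular g ∧ IsOneWay g ∧ IsHardCorePredicate B g) :
    ∃ V : List Bool → List Bool → Bool, IsProofSystemFor V TAUT ∧ STHyp V := by
  obtain ⟨g, B, hinj, -, hg, hB⟩ := hA
  exact stub_bridge stub_levin g B hg.1 hB.1 hinj (stub_game g B hg hB)

/-- **Hypothesis (ST) from a uniform one-way permutation** (registered sub-goal
`st_of_oneWayPermutation`): a length-preserving, length-wise injective one-way `f` gives the injective
family `glFun f` with hard-core bit `glPred` (Goldreich–Levin, proved in the tree), hence (ST).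
[cite: Krajicek2020KPT, main theorem] -/
theorem st_of_oneWayPermutation
    (h : ∃ f : List Bool → List Bool, IsOneWay f ∧ IsLengthPreserving f ∧
      ∀ x y : List Bool, x.length = y.length → f x = f y → x = y) :
    ∃ V : List Bool → List Bool → Bool, IsProofSystemFor V TAUT ∧ STHyp V := by
  obtain ⟨g, B, hinj, hreg, hg, hB⟩ := injOWF_of_oneWayPermutation h
  exact st_of_injOWF ⟨g, B, hinj, hreg, hg, hB⟩

/-- **The line's closure of the crux modulo its two apexes** (registered sub-goal
`latticeMagicTarget_of_injOWF_of_squeeze`): apex A (an injective one-way family with a hard-core bit)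
gives (ST) (`st_of_injOWF`); apex B (Krajíček's Thm 4.1 with the model-extension property MEP folded in:
every Cook–Reckhow proof system for `TAUT` with an ST-hard `DD` problem forces `NP ≠ coNP`) turns it into
`NP ≠ coNP`; the landed `latticeMagicTarget_of_NP_ne_coNP` gives `Target`.
(Source of the shape: J. Krajíček, arXiv:2506.20221, Thm 4.1.) [folklore] -/
theorem latticeMagicTarget_of_injOWF_of_squeeze
    (hA : ∃ (g : List Bool → List Bool) (B : List Bool → Bool),
      InjOnLengths g ∧ IsLengthRegular g ∧ IsOneWay g ∧ IsHardCorePredicate B g)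
    (hB : ∀ V : List Bool → List Bool → Bool, IsProofSystemFor V TAUT → STHyp V →
      Nondeterministic.NP ≠ coNP) :
    Target := by
  obtain ⟨V, hV, hST⟩ := st_of_injOWF hA
  exact Summit.PneNP.PneNP.Theorems.latticeMagicTarget_of_NP_ne_coNP (hB V hV hST)

/-- **The price, kernel-checked** (registered sub-goal `squeeze_iff_NP_ne_coNP_of_injOWF`): given apex A,
apex B is EQUIVALENT to `NP ≠ coNP` — hence to the crux `Target` (`latticeMagicTarget_iff_NP_ne_coNP`).
So under the cryptographic leg the squeeze leaves exactly the crux; what it would take to make apex B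
smaller is Krajíček's open Problem 3.2 (MEP) stated and proved, not a reshape. [folklore] -/
theorem squeeze_iff_NP_ne_coNP_of_injOWF
    (hA : ∃ (g : List Bool → List Bool) (B : List Bool → Bool),
      InjOnLengths g ∧ IsLengthRegular g ∧ IsOneWay g ∧ IsHardCorePredicate B g) :
    (∀ V : List Bool → List Bool → Bool, IsProofSystemFor V TAUT → STHyp V →
        Nondeterministic.NP ≠ coNP) ↔ Nondeterministic.NP ≠ coNP := by
  obtain ⟨V, hV, hST⟩ := st_of_injOWF hA
  exact ⟨fun h => h V hV hST, fun h _ _ _ => h⟩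

/-- Apex B is implied by `TAUT ∈ P` (in particular by `P = NP`): then no complete proof system has an
ST-hard `DD` problem (`stHyp_false_of_TAUT_mem_P`), so the implication is vacuous. Together with
`squeeze_iff_NP_ne_coNP_of_injOWF`: apex B is NOT by itself ≥ `NP ≠ coNP`; its weight is relative to
apex A. [folklore] -/
theorem squeeze_of_TAUT_mem_P (hT : TAUT ∈ Classes.P) (V : List Bool → List Bool → Bool)
    (hV : IsProofSystemFor V TAUT) (hST : STHyp V) : Nondeterministic.NP ≠ coNP :=
  absurd hST (stHyp_false_of_TAUT_mem_P V hV hT)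

end Summit.PneNP.PneNP.Theorems.LatticeMagicTarget
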